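import Summits.NavierStokesRegularity.NavierStokesRegularity.Theorems.WakeRatchetEternalInviscidRateLeakRatchet
import Summits.NavierStokesRegularity.NavierStokesRegularity.Theorems.WakeRatchetRatchetStarvation
import Summits.NavierStokesRegularity.NavierStokesRegularity.Theorems.WakeRatchetTailEnvelopeFinite

/-!
# Conveyor ledger (crux `WakeRatchet.EternalInviscidRate`, ⟨stmt-NavierStokesRegularity-25646⟩) —
# what the LEAK RATCHET already gives toward the route's target: STARVATION IN THE LOG-ACTION REGIME

The route WakeRatchet closes its rung leaf by `TailRatchet(w) → TailEnvelopeFinite → RatchetStarvation → …`: a per-shell tail contraction by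
`1 − w` with `(1+ε₀)(1−w) < 1` starves every forward (S₁)-surviving bounded eternal solution.  The landed LEAK RATCHET (…LeakRatchet,
`tail_succ_le_leak_envelope`) supplies that contraction for EVERY uniformly bounded admissible INVISCID eternal solution of a cancelling table
with the SOLUTION-DEPENDENT fraction `w = e^{−κ}`, `κ := 2C_AΛ⁻¹M` (`M` the uniform action bound).  Feeding it to the landed route supports
`wakeRatchet_tailEnvelopeFinite_proof` / `wakeRatchet_ratchetStarvation_proof` gives, with no self-similarity and no smallness of `ε₀`:
* `not_survivingFwd_of_leak` — if `(1+ε₀)·(1 − e^{−2C_AΛ⁻¹M}) < 1` then `W` is NOT forward (S₁)-surviving;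
* `not_survivingFwd_of_action_lt_log` — in particular whenever `2C_AΛ⁻¹M < log(1 + 1/ε₀)`: **a bounded admissible inviscid eternal
  solution whose shells make fewer than `log(1+1/ε₀)` weighted turnovers (`2C_AΛ⁻¹∫‖W_n‖ < log(1+1/ε₀)` for every `n`) cannot survive
  forward.**  This is a LOG-ACTION Liouville regime for the K1⁰ statement `NoSurvivingEternalBdd R 1` (the tree's small-action rung
  `…NoSurvivingEternalViscBddOneSmallActionRung.not_survivingFwd_of_smallAction` needs `(2+ε₀)·2C_AΛ⁻¹M < 1`, an `O(1)` budget; here the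
  budget grows like `log(1/ε₀)`).  K41 fronts carry `M ~ 1/ε₀ ≫ log(1/ε₀)`: the complement is exactly where the rate cruxes live.
MODEL lattice only (Tao 2016 §4 renormalised cascade); nothing here is a statement about the Navier–Stokes equations, no stub or crux is
closed by this file, no summit is proved.
[cite: Tao2016AveragedNS, §4 Lemma 4.1 (4.8)–(4.10) with the cancellation (4.3), in the self-similar variables of §6.4]
-/

noncomputable section

set_option linter.dupNamespace false

open Filter Topology Set MeasureTheory
open Literature.Analysis.FluidPDE Literature.Analysis.FluidPDE.TaoCascade
open Summit.NavierStokesRegularity.NavierStokesRegularity.Theorems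

namespace Summit.NavierStokesRegularity.NavierStokesRegularity.Cruxes.EternalInviscidRate.FinalWakeLedger

variable {ε₀ : ℝ} {α : Fin 4 → Fin 4 → Fin 4 → ℤ × ℤ × ℤ → ℝ} {W : ℤ → ℝ → Em 4}

/-- **Starvation from the leak ratchet.**  A uniformly bounded admissible inviscid eternal solution of a cancelling table (`ε₀ > 0`) with
uniform action bound `M` and `(1+ε₀)·(1 − e^{−2C_AΛ⁻¹M}) < 1` is not forward (S₁)-surviving: the leak ratchet is the tail contraction that the
landed `RatchetStarvation` consumes, with `w = e^{−2C_AΛ⁻¹M}`.  MODEL lattice only.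
[cite: Tao2016AveragedNS, §4 Lemma 4.1 (4.8)–(4.10) with the cancellation (4.3), §6.4] -/
theorem not_survivingFwd_of_leak (hε : 0 < ε₀) (hc : IsCancellingCoeff α) (hW : IsEternal ε₀ α W) (hU : UniformBound W)
    {M : ℝ} (hM : ∀ k : ℤ, Integrable (fun σ => ‖W k σ‖) ∧ ∫ σ, ‖W k σ‖ ≤ M)
    (hsmall : (1 + ε₀) * (1 - Real.exp (-(2 * fluxConst α * (bigLam ε₀)⁻¹ * M))) < 1) :
    ¬ EternalSurvivingFwd 1 ε₀ W := by
  set w : ℝ := Real.exp (-(2 * fluxConst α * (bigLam ε₀)⁻¹ * M)) with hw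
  have hw0 : 0 < w := Real.exp_pos _
  have hWv : IsEternalVisc ε₀ 0 α W := hW.isEternalVisc
  have hEnv := wakeRatchet_tailEnvelopeFinite_proof ε₀ 0 α W hε hc hWv hU
  have hq : (1 + ε₀) * (1 - w) < 1 := hsmall
  refine wakeRatchet_ratchetStarvation_proof ε₀ w 0 α W hε hw0 hq hWv hU hEnv ?_
  intro n Θ hΘ σ
  have h := tail_succ_le_leak_envelope hε hc hW hU n hΘ (hM (n + 1)).1 (hM (n + 1)).2 σ
  simpa [hw] using h

/-- **LOG-ACTION LIOUVILLE REGIME.**  A uniformly bounded admissible inviscid eternal solution of a cancelling table whose uniform action bound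
satisfies `2C_AΛ⁻¹M < log(1 + 1/ε₀)` is not forward (S₁)-surviving.  MODEL lattice only.
[cite: Tao2016AveragedNS, §4 Lemma 4.1 (4.8)–(4.10) with the cancellation (4.3), §6.4] -/
theorem not_survivingFwd_of_action_lt_log (hε : 0 < ε₀) (hc : IsCancellingCoeff α) (hW : IsEternal ε₀ α W)
    (hU : UniformBound W) {M : ℝ} (hM : ∀ k : ℤ, Integrable (fun σ => ‖W k σ‖) ∧ ∫ σ, ‖W k σ‖ ≤ M)
    (hlog : 2 * fluxConst α * (bigLam ε₀)⁻¹ * M < Real.log (1 + 1 / ε₀)) :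
    ¬ EternalSurvivingFwd 1 ε₀ W := by
  refine not_survivingFwd_of_leak hε hc hW hU hM ?_
  set κ : ℝ := 2 * fluxConst α * (bigLam ε₀)⁻¹ * M with hκ
  -- `e^{-κ} > e^{-log(1+1/ε₀)} = ε₀/(1+ε₀)`
  have h1 : 0 < 1 + 1 / ε₀ := by positivity
  have hexp : ε₀ / (1 + ε₀) < Real.exp (-κ) := by
    have h2 : Real.exp (-Real.log (1 + 1 / ε₀)) = ε₀ / (1 + ε₀) := by
      rw [Real.exp_neg, Real.exp_log h1]
      field_simp
      ring
    rw [← h2]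
    exact Real.exp_lt_exp.2 (by linarith)
  -- `(1+ε₀)(1 − e^{−κ}) < (1+ε₀)(1 − ε₀/(1+ε₀)) = 1`
  have h3 : (1 + ε₀) * (1 - ε₀ / (1 + ε₀)) = 1 := by field_simp; ring
  have h4 : (1 + ε₀) * (1 - Real.exp (-κ)) < (1 + ε₀) * (1 - ε₀ / (1 + ε₀)) :=
    mul_lt_mul_of_pos_left (by linarith) (by linarith)
  linarith

end Summit.NavierStokesRegularity.NavierStokesRegularity.Cruxes.EternalInviscidRate.FinalWakeLedger

end
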